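import Literature.NumberTheory.IwasawaTheory.ClassGroupPRankLeOneOfCardFixedLeTwoLayerTwo
import HarnessLib

/-!
# The converse quadrant at `p = 2`, ALGEBRA AND GROUP BRICKS: a cyclic `2`-group with one endomorphism `φ` has `#M/(φ−1)M ≤ 2` or `#M/(φ+1)M ≤ 2`;
# hence fixed points `≥ 4` and `(1+α)`-quotient `≥ 4` force `2`-rank `≥ 2` (the tower door is the sequel `ClassGroupPRankTwoLeOfCardFixedLayerTwo`)

Topic `NumberTheory/IwasawaTheory` (namespace = path).  THEOREM-ONLY file (no definition, no named fact, no instance, no `sorry`), written by the prover seat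
`bsd-line-att-p3` g46 (cell `bsd-f1-sign2`, route `AlignedTransportAtTwo`; `--supports` stmt-BirchSwinnertonDyer-22298, closes nothing; no class group is computed here).
Third panel of the layer-two triptych: the DEPTH DOOR (`ClassGroupPRankLeOneOfAmbiguousLayerTwo`, g42: `e₁ ≤ 1 ∧ 4 ∣ #Cl(K_2)^G ⟹ rank ≤ 1`), the PRO-CYCLIC DOOR
(`ClassGroupPRankLeOneOfCardFixedLeTwoLayerTwo`, this seat: `e₁ ≥ 2 ∧ 4 ∤ #Cl(K_2)^G ⟹ rank ≤ 1`), and HERE the remaining quadrant **`e₁ ≥ 2 ∧ 4 ∣ #Cl(K_2)^G ⟹ rank₂ Cl(K_2) ≥ 2`**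
— a TRIAGE theorem: on that class the Iwasawa module is not pro-cyclic (in `Λ`-terms `J` contains no `T − a`: `v₂(a) ≥ 2` would give `e₁ = v₂(2 + a) = 1`, `v₂(a) = 1` would give
`#X/TX = 2`; so `μ₂ > 0` or `λ₂ ≥ 2`), and the only finite-level decider left is `rank₂ Cl(K_2) ≤ 2` itself (door L10 at `j = 2`), a class-group rank of the degree-`4[K:ℚ]` layer.

ALGEBRA (`FukudaDepth.card_quotient_le_two_or_of_card_quotient_two_le_two`): a finite abelian `2`-group `M` with `#M/2M ≤ 2` is CYCLIC, an endomorphism `φ` acts as an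
integer `u`, and one of `u − 1`, `u + 1` is odd or twice an odd number — so **`#M/(φ−1)M ≤ 2` or `#M/(φ+1)M ≤ 2`**; contrapositive `four_le_card_quotient_two_of_four_le`.
GROUP (`natCard_sq_eq_one_four_le_of_four_dvd_card_fixed`): `α ∈ Aut G`, `4 ∣ #G^α`, `N : G ↠ H` with `4 ∣ #H` killing `g·αg` on `2`-primary `g` ⟹ `#G[2] ≥ 4`.
USE (cell bsd-f1-sign2, crux C2): the class `t ≥ 4 ∧ e₁ ≥ 2` of the typed census (`1187`, `4307`, `14539`, `5747`), via the sequel.  HONEST SCOPE: elementary; nothing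
specific to any summit; BSD is not advanced by this file.  Not found in print in this form; ingredients cited at each use (D-0014).

References: [Washington1997] §13.3 Lemmas 13.15, 13.18, Prop. 13.22; [Lang1990] Ch. 5 §2 (Weierstrass preparation), Ch. 13 §4 Lemma 4.1; [NeukirchANT1999] Ch. III §1 (1.6)(iv);
[Fukuda1994] Thm. 1 (2), p. 264.
-/

set_option autoImplicit false

noncomputable section
open Finset NumberField IsDedekindDomain Field IntermediateField
open scoped NumberField
/-! ## §1 Algebra: a cyclic `2`-group and one endomorphism -/

namespace Literature.NumberTheory.IwasawaTheory.FukudaDepth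

variable {M : Type*} [AddCommGroup M] [Finite M]

/-- `#(X/f(X)) = #ker f` for an endomorphism `f` of a finite abelian group. [folklore] -/
private theorem card_quotient_range_eq_card_ker'' (f : Module.End ℤ M) :
    Nat.card (M ⧸ LinearMap.range f) = Nat.card (LinearMap.ker f) := by
  have h1 : Nat.card (LinearMap.ker f) * Nat.card (LinearMap.range f) = Nat.card M := by
    rw [← Nat.card_congr (LinearMap.quotKerEquivRange f).toEquiv]
    exact (Submodule.card_eq_card_quotient_mul_card (LinearMap.ker f)).symm
  have h2 : Nat.card (LinearMap.range f) * Nat.card (M ⧸ LinearMap.range f) = Nat.card M :=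
    (Submodule.card_eq_card_quotient_mul_card (LinearMap.range f)).symm
  have hpos : 0 < Nat.card (LinearMap.range f) := Nat.card_pos
  apply Nat.eq_of_mul_eq_mul_left hpos
  rw [h2, ← h1, mul_comm]

omit [Finite M] in
/-- An odd integer acts bijectively (here: surjectively) on a finite abelian group of `2`-power order (Bézout with `#M = 2^a`, `#M • m = 0`). [folklore] -/
private theorem exists_smul_eq_of_odd (hM : ∃ a : ℕ, Nat.card M = 2 ^ a) {c : ℤ} (hc : Odd c) (m : M) : ∃ m' : M, c • m' = m := by
  obtain ⟨a, ha⟩ := hM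
  have hcop : IsCoprime c ((2 : ℤ) ^ a) := by
    rw [Int.isCoprime_iff_gcd_eq_one]
    have h2 : Int.gcd c 2 = 1 := by
      rw [Int.gcd_comm]
      exact Int.isCoprime_iff_gcd_eq_one.mp ((Int.prime_two.coprime_iff_not_dvd).mpr (by
        rintro ⟨k, rfl⟩; exact Int.not_even_iff_odd.mpr hc ⟨k, by ring⟩))
    exact Int.gcd_pow_right_of_gcd_eq_one h2
  obtain ⟨s, t, hst⟩ := hcop
  refine ⟨s • m, ?_⟩
  have hkill : ((2 : ℤ) ^ a) • m = 0 := by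
    have h : Nat.card M • m = 0 := card_nsmul_eq_zero'
    rw [ha, ← natCast_zsmul] at h
    push_cast at h
    exact h
  calc c • s • m = (s * c) • m := by rw [smul_smul, mul_comm]
    _ = (1 - t * 2 ^ a) • m := by rw [← hst]; ring_nf
    _ = m := by rw [sub_smul, one_smul, mul_smul, hkill, smul_zero, sub_zero]

/-- A finite abelian `2`-group with `#(M/2M) ≤ 2` is cyclic: some `x` with `M = ℤx` (`M = ℤx + 2M`, then `2^a M = 0`). [cite: Lang1990, Ch. 5 §1 (finite `ℤ_p`-modules)] -/
private theorem exists_forall_eq_zsmul (hM : ∃ a : ℕ, Nat.card M = 2 ^ a)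
    (h2 : Nat.card (M ⧸ (⊤ : Submodule ℤ M).map ((2 : ℤ) • (1 : Module.End ℤ M))) ≤ 2) :
    ∃ x : M, ∀ m : M, ∃ k : ℤ, m = k • x := by
  classical
  set P : Submodule ℤ M := (⊤ : Submodule ℤ M).map ((2 : ℤ) • (1 : Module.End ℤ M)) with hP
  have hPmem : ∀ {m : M}, m ∈ P ↔ ∃ m', m = (2 : ℤ) • m' := by
    intro m
    constructor
    · rintro ⟨m', -, rfl⟩; exact ⟨m', rfl⟩
    · rintro ⟨m', rfl⟩; exact ⟨m', Submodule.mem_top, rfl⟩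
  haveI : Finite (M ⧸ P) := Finite.of_surjective _ (Submodule.Quotient.mk_surjective P)
  -- a generator of `M/P` (of order `≤ 2`): some `x` with every `m ∈ {x, 0} + P`
  have hx : ∃ x : M, ∀ m : M, m ∈ P ∨ m - x ∈ P := by
    by_cases hall : ∀ m : M, m ∈ P
    · exact ⟨0, fun m => Or.inl (hall m)⟩
    · obtain ⟨x, hx⟩ := not_forall.mp hall
      refine ⟨x, fun m => ?_⟩
      have hx0 : (Submodule.Quotient.mk x : M ⧸ P) ≠ 0 := fun h => hx ((Submodule.Quotient.mk_eq_zero P).mp h)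
      haveI : Nontrivial (M ⧸ P) := ⟨⟨_, _, hx0⟩⟩
      have hcard : Nat.card (M ⧸ P) = 2 := le_antisymm h2 (Finite.one_lt_card_iff_nontrivial.mpr inferInstance)
      obtain ⟨y, -, huniq⟩ := (Nat.card_eq_two_iff' (0 : M ⧸ P)).mp hcard
      by_cases hm : (Submodule.Quotient.mk m : M ⧸ P) = 0
      · exact Or.inl ((Submodule.Quotient.mk_eq_zero P).mp hm)
      · right
        have hmx : (Submodule.Quotient.mk m : M ⧸ P) = Submodule.Quotient.mk x := by rw [huniq _ hm, huniq _ hx0]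
        exact (Submodule.Quotient.eq P).mp hmx
  obtain ⟨x, hx⟩ := hx
  refine ⟨x, ?_⟩
  -- `m ∈ ℤx + 2^j M` for every `j`, by induction; then `2^a M = 0`
  have hstep : ∀ m : M, ∃ (k : ℤ) (m' : M), m = k • x + (2 : ℤ) • m' := by
    intro m
    rcases hx m with h | h
    · obtain ⟨m', hm'⟩ := hPmem.mp h
      exact ⟨0, m', by rw [zero_smul, zero_add]; exact hm'⟩
    · obtain ⟨m', hm'⟩ := hPmem.mp h
      exact ⟨1, m', by rw [one_smul, ← hm']; abel⟩
  have hiter : ∀ (j : ℕ) (m : M), ∃ (k : ℤ) (m' : M), m = k • x + ((2 : ℤ) ^ j) • m' := by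
    intro j
    induction j with
    | zero => intro m; exact ⟨0, m, by simp⟩
    | succ j ih =>
      intro m
      obtain ⟨k, m', hm⟩ := ih m
      obtain ⟨k', m'', hm'⟩ := hstep m'
      refine ⟨k + 2 ^ j * k', m'', ?_⟩
      rw [hm, hm', smul_add, smul_smul, smul_smul, add_smul, pow_succ]
      abel
  obtain ⟨a, ha⟩ := hM
  intro m
  obtain ⟨k, m', hm⟩ := hiter a m
  refine ⟨k, ?_⟩
  have hkill : ((2 : ℤ) ^ a) • m' = 0 := by
    have h : Nat.card M • m' = 0 := card_nsmul_eq_zero'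
    rw [ha, ← natCast_zsmul] at h
    push_cast at h
    exact h
  rw [hm, hkill, add_zero]

/-- ★ **On a cyclic `2`-group every endomorphism `φ` has `#M/(φ−1)M ≤ 2` or `#M/(φ+1)M ≤ 2`.**  `M` a finite abelian group of `2`-power order with `#(M/2M) ≤ 2`, `φ ∈ End_ℤ(M)`:
`φ` is multiplication by an integer `u`; if `u` is even, `u − 1` is odd and `φ − 1` is onto; if `u ≡ 3 (4)` then `(φ−1)M = 2M`; if `u ≡ 1 (4)` then `(φ+1)M = 2M`.
(In `Λ`-terms: a quotient of `Λ/(T − a)` has `#X/TX ≤ 2` or `#X/(T+2)X ≤ 2`.) [cite: Lang1990, Ch. 5 §2 (Weierstrass preparation: linear distinguished polynomials)]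
[cite: Washington1997, §13.3 Lemma 13.18] -/
theorem card_quotient_le_two_or_of_card_quotient_two_le_two (hM : ∃ a : ℕ, Nat.card M = 2 ^ a)
    (h2 : Nat.card (M ⧸ (⊤ : Submodule ℤ M).map ((2 : ℤ) • (1 : Module.End ℤ M))) ≤ 2) (φ : Module.End ℤ M) :
    Nat.card (M ⧸ (⊤ : Submodule ℤ M).map (φ - 1)) ≤ 2 ∨ Nat.card (M ⧸ (⊤ : Submodule ℤ M).map (φ + 1)) ≤ 2 := by
  classical
  obtain ⟨x, hx⟩ := exists_forall_eq_zsmul hM h2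
  obtain ⟨u, hu⟩ := hx (φ x)
  -- `φ = u • id`
  have hφ : ∀ m : M, φ m = u • m := by
    intro m
    obtain ⟨k, rfl⟩ := hx m
    rw [map_zsmul, hu, smul_smul, smul_smul, mul_comm]
  -- quotients by `c • M` for `c` odd (trivial) or `c = 2·odd` (equal to `M/2M`)
  have hsurj : ∀ {c : ℤ}, Odd c → ∀ (f : Module.End ℤ M), (∀ m, f m = c • m) →
      Nat.card (M ⧸ (⊤ : Submodule ℤ M).map f) ≤ 2 := by
    intro c hc f hf
    have htop : (⊤ : Submodule ℤ M).map f = ⊤ := by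
      rw [eq_top_iff]
      intro m _
      obtain ⟨m', hm'⟩ := exists_smul_eq_of_odd hM hc m
      exact ⟨m', Submodule.mem_top, by rw [hf, hm']⟩
    rw [htop]
    haveI : Subsingleton (M ⧸ (⊤ : Submodule ℤ M)) := subsingleton_of_forall_eq 0 fun q => by
      obtain ⟨m, rfl⟩ := Submodule.Quotient.mk_surjective (⊤ : Submodule ℤ M) q
      exact (Submodule.Quotient.mk_eq_zero ⊤).mpr Submodule.mem_top
    exact (Nat.card_of_subsingleton (0 : M ⧸ (⊤ : Submodule ℤ M))).le.trans (by norm_num)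
  have htwice : ∀ {c : ℤ}, Odd c → ∀ (f : Module.End ℤ M), (∀ m, f m = (2 * c) • m) →
      Nat.card (M ⧸ (⊤ : Submodule ℤ M).map f) ≤ 2 := by
    intro c hc f hf
    have heq : (⊤ : Submodule ℤ M).map f = (⊤ : Submodule ℤ M).map ((2 : ℤ) • (1 : Module.End ℤ M)) := by
      apply le_antisymm
      · rintro _ ⟨m, -, rfl⟩
        exact ⟨c • m, Submodule.mem_top, by rw [hf, LinearMap.smul_apply, Module.End.one_apply, smul_smul]⟩
      · rintro _ ⟨m, -, rfl⟩
        obtain ⟨m', hm'⟩ := exists_smul_eq_of_odd hM hc m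
        exact ⟨m', Submodule.mem_top, by rw [hf, LinearMap.smul_apply, Module.End.one_apply, ← hm', smul_smul]⟩
    rw [heq]; exact h2
  -- `u mod 4`
  have hφm1 : ∀ m, (φ - 1) m = (u - 1) • m := fun m => by
    rw [LinearMap.sub_apply, Module.End.one_apply, hφ, sub_smul, one_smul]
  have hφp1 : ∀ m, (φ + 1) m = (u + 1) • m := fun m => by
    rw [LinearMap.add_apply, Module.End.one_apply, hφ, add_smul, one_smul]
  obtain ⟨q, hdiv⟩ : ∃ q : ℤ, u = 4 * q ∨ u = 4 * q + 1 ∨ u = 4 * q + 2 ∨ u = 4 * q + 3 := ⟨u / 4, by omega⟩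
  rcases hdiv with hdiv | hdiv | hdiv | hdiv
  · exact Or.inl (hsurj (c := u - 1) ⟨2 * q - 1, by rw [hdiv]; ring⟩ (φ - 1) hφm1)
  · exact Or.inr (htwice (c := 2 * q + 1) ⟨q, rfl⟩ (φ + 1) fun m => by rw [hφp1, hdiv]; congr 1; ring)
  · exact Or.inl (hsurj (c := u - 1) ⟨2 * q, by rw [hdiv]; ring⟩ (φ - 1) hφm1)
  · exact Or.inl (htwice (c := 2 * q + 1) ⟨q, rfl⟩ (φ - 1) fun m => by rw [hφm1, hdiv]; congr 1; ring)

/-- ★★ **The converse quadrant: `#ker(φ − 1) ≥ 4` and `#M/(1+φ)M ≥ 4` force `#M/2M ≥ 4`** (`M` a finite abelian `2`-group, `φ` any endomorphism): otherwise `M` would be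
cyclic and the previous lemma applies (`#M/(φ−1)M = #ker(φ−1)`). [cite: Washington1997, §13.3 Lemmas 13.15, 13.18 and Prop. 13.22] [cite: Lang1990, Ch. 5 §2] -/
theorem four_le_card_quotient_two_of_four_le (hM : ∃ a : ℕ, Nat.card M = 2 ^ a) (φ : Module.End ℤ M)
    (h1 : 4 ≤ Nat.card (LinearMap.ker (φ - 1))) (h2 : 4 ≤ Nat.card (M ⧸ (⊤ : Submodule ℤ M).map (1 + φ))) :
    4 ≤ Nat.card (M ⧸ (⊤ : Submodule ℤ M).map ((2 : ℤ) • (1 : Module.End ℤ M))) := by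
  classical
  set P : Submodule ℤ M := (⊤ : Submodule ℤ M).map ((2 : ℤ) • (1 : Module.End ℤ M)) with hP
  haveI : Finite (M ⧸ P) := Finite.of_surjective _ (Submodule.Quotient.mk_surjective P)
  -- `#(M/2M)` is a power of `2`
  obtain ⟨a, ha⟩ := hM
  have hdvd : Nat.card (M ⧸ P) ∣ 2 ^ a := by
    rw [← ha]; exact Dvd.intro_left _ (Submodule.card_eq_card_quotient_mul_card P).symm
  obtain ⟨b, -, hb⟩ := (Nat.dvd_prime_pow Nat.prime_two).mp hdvd
  by_contra hlt
  rw [not_le] at hlt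
  have hle2 : Nat.card (M ⧸ P) ≤ 2 := by
    rw [hb] at hlt ⊢
    rcases Nat.lt_or_ge b 2 with hb2 | hb2
    · interval_cases b <;> norm_num
    · exfalso
      have : 4 ≤ 2 ^ b := by
        calc (4 : ℕ) = 2 ^ 2 := by norm_num
          _ ≤ 2 ^ b := Nat.pow_le_pow_right (by norm_num) hb2
      omega
  rcases card_quotient_le_two_or_of_card_quotient_two_le_two ⟨a, ha⟩ hle2 φ with h | h
  · rw [Submodule.map_top, card_quotient_range_eq_card_ker''] at h
    omega
  · rw [add_comm] at h
    omega

end Literature.NumberTheory.IwasawaTheory.FukudaDepth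
/-! ## §2 Finite commutative groups: fixed points and the `(1+α)`-quotient both of size `≥ 4` force `2`-rank `≥ 2` -/

namespace Literature.NumberTheory.IwasawaTheory

section Group

variable {G H : Type*} [CommGroup G] [Finite G] [CommGroup H] [Finite H]

omit [Finite H] in
/-- A `2`-primary element of `H` is the image of a `2`-PRIMARY element of `G` under a surjection `N : G → H`. [folklore] -/
private theorem exists_primary_preimage_of_surjective' (N : G →* H) (hN : Function.Surjective N) {m : ℕ} {b : H}
    (hb : b ^ 2 ^ m = 1) : ∃ a : G, a ∈ CommGroup.primaryComponent G 2 ∧ N a = b := by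
  classical
  haveI : Fintype G := Fintype.ofFinite G
  set h := Fintype.card G with hh
  have h0 : h ≠ 0 := Fintype.card_ne_zero
  set s := h.factorization 2 with hs
  set u := h / 2 ^ s with hu
  have hpu : Nat.Coprime u (2 ^ m) := (Nat.coprime_ordCompl Nat.prime_two h0).symm.pow_right m
  have hhu : 2 ^ s * u = h := Nat.ordProj_mul_ordCompl_eq_self h 2
  obtain ⟨a₀, rfl⟩ := hN b
  rcases Nat.lt_or_ge 1 (2 ^ m) with hm | hm
  · obtain ⟨v, -, hv⟩ := Nat.exists_mul_mod_eq_one_of_coprime hpu hm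
    refine ⟨a₀ ^ (u * v), (CommGroup.mem_primaryComponent).mpr ⟨s, ?_⟩, ?_⟩
    · rw [← pow_mul, mul_comm (u * v), ← mul_assoc, hhu, pow_mul, hh, pow_card_eq_one, one_pow]
    · rw [map_pow]
      have huv : u * v = 2 ^ m * (u * v / 2 ^ m) + 1 := by
        have := Nat.div_add_mod (u * v) (2 ^ m); rw [hv] at this; exact this.symm
      rw [huv, pow_add, pow_one, pow_mul, hb, one_pow, one_mul]
  · have hm1 : 2 ^ m = 1 := le_antisymm hm Nat.one_le_two_pow
    rw [hm1, pow_one] at hb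
    exact ⟨1, Subgroup.one_mem _, by rw [map_one, hb]⟩

/-- ★★ **The converse quadrant for a finite commutative group.**  `α` an automorphism of `G` whose fixed points are divisible by `4` in number; `N : G ↠ H` onto a group of
order divisible by `4`, killing `g·αg` for every `2`-primary `g`.  Then **`#{g : g² = 1} ≥ 4`** (the `2`-part of `G` is NOT cyclic): on `P = G[2^∞]`, `#P^α ≥ 4` and
`#P/(1+α)P ≥ #H[2^∞] ≥ 4`, then `FukudaDepth.four_le_card_quotient_two_of_four_le`. [cite: Washington1997, §13.3 Lemma 13.18 and Prop. 13.22] [cite: Lang1990, Ch. 13 §4 Lemma 4.1] -/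
theorem natCard_sq_eq_one_four_le_of_four_dvd_card_fixed (α : G ≃* G)
    (hfix : 4 ∣ Nat.card {g : G // α g = g}) (N : G →* H) (hN : Function.Surjective N) (h4 : 4 ∣ Nat.card H)
    (hker : ∀ g : G, g ∈ CommGroup.primaryComponent G 2 → N (g * α g) = 1) :
    4 ≤ Nat.card {g : G // g ^ 2 = 1} := by
  classical
  haveI : Fact (Nat.Prime 2) := ⟨Nat.prime_two⟩
  set P : Subgroup G := CommGroup.primaryComponent G 2 with hP
  have hPmem : ∀ {g : G}, g ∈ P ↔ ∃ k : ℕ, g ^ 2 ^ k = 1 := fun {g} => CommGroup.mem_primaryComponent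
  have hαP : ∀ g : P, α (g : G) ∈ P := fun g => by
    obtain ⟨k, hk⟩ := hPmem.mp g.2
    exact hPmem.mpr ⟨k, by rw [← map_pow, hk, map_one]⟩
  let αP : P →* P :=
    { toFun := fun g => ⟨α g, hαP g⟩
      map_one' := Subtype.ext (by simp)
      map_mul' := fun a b => Subtype.ext (by simp) }
  have hαP_apply : ∀ g : P, ((αP g : P) : G) = α g := fun _ => rfl
  let φ : Module.End ℤ (Additive P) := (MonoidHom.toAdditive αP).toIntLinearMap
  have hφ_apply : ∀ x : Additive P, φ x = Additive.ofMul (αP (Additive.toMul x)) := fun _ => rfl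
  have hM : ∃ a : ℕ, Nat.card (Additive P) = 2 ^ a := (CommGroup.primaryComponent.isPGroup (G := G) (p := 2)).exists_card_eq
  -- (1) `#ker(φ - 1) ≥ 4`: the `2`-part of the fixed subgroup lies in `P`
  have h1 : 4 ≤ Nat.card (LinearMap.ker (φ - 1)) := by
    let Fix : Subgroup G :=
      { carrier := {g | α g = g}
        mul_mem' := fun {a b} ha hb => by
          simp only [Set.mem_setOf_eq] at ha hb ⊢
          rw [map_mul, ha, hb]
        one_mem' := by simp
        inv_mem' := fun {a} ha => by
          simp only [Set.mem_setOf_eq] at ha ⊢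
          rw [map_inv, ha] }
    have hFix : Nat.card Fix = Nat.card {g : G // α g = g} := Nat.card_congr (Equiv.subtypeEquivRight fun _ => Iff.rfl)
    have hiff : ∀ x : Additive P, x ∈ LinearMap.ker (φ - 1) ↔ ((Additive.toMul x : P) : G) ∈ P ⊓ Fix := by
      intro x
      rw [LinearMap.mem_ker, LinearMap.sub_apply, Module.End.one_apply, sub_eq_zero, Subgroup.mem_inf]
      constructor
      · intro h
        refine ⟨(Additive.toMul x).2, ?_⟩
        change α ((Additive.toMul x : P) : G) = _
        have := congrArg (fun y : Additive P => ((Additive.toMul y : P) : G)) h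
        simpa only [hφ_apply, toMul_ofMul, hαP_apply] using this
      · rintro ⟨-, h⟩
        change α ((Additive.toMul x : P) : G) = ((Additive.toMul x : P) : G) at h
        apply Additive.toMul.injective
        exact Subtype.ext (by simp only [hφ_apply, toMul_ofMul, hαP_apply, h])
    let e : LinearMap.ker (φ - 1) ≃ (P ⊓ Fix : Subgroup G) :=
      { toFun := fun x => ⟨((Additive.toMul (x : Additive P) : P) : G), (hiff x.1).mp x.2⟩
        invFun := fun g => ⟨Additive.ofMul ⟨(g : G), (Subgroup.mem_inf.mp g.2).1⟩, (hiff _).mpr (by simp only [toMul_ofMul]; exact g.2)⟩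
        left_inv := fun x => by apply Subtype.ext; apply Additive.toMul.injective; exact Subtype.ext rfl
        right_inv := fun g => Subtype.ext rfl }
    rw [Nat.card_congr e]
    -- a Sylow `2`-subgroup of `Fix` has order `≥ 4` and injects into `P ⊓ Fix`
    haveI : Finite Fix := inferInstance
    obtain ⟨Q⟩ : Nonempty (Sylow 2 Fix) := inferInstance
    have hQcard : 4 ≤ Nat.card Q := by
      have hdvd : 4 ∣ Nat.card Q := by
        rw [Q.card_eq_multiplicity, hFix]
        have hne : Nat.card {g : G // α g = g} ≠ 0 := by rw [← hFix]; exact Nat.card_pos.ne'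
        have h22 : 2 ≤ (Nat.card {g : G // α g = g}).factorization 2 :=
          (Nat.Prime.pow_dvd_iff_le_factorization Nat.prime_two hne).mp (by norm_num; exact hfix)
        exact (pow_dvd_pow 2 h22).trans (by norm_num)
      exact Nat.le_of_dvd Nat.card_pos hdvd
    let f : Q → (P ⊓ Fix : Subgroup G) := fun q => ⟨((q : Fix) : G), by
      refine Subgroup.mem_inf.mpr ⟨?_, (q : Fix).2⟩
      obtain ⟨k, hk⟩ := Q.isPGroup' q
      refine hPmem.mpr ⟨k, ?_⟩
      have := congrArg (fun z : Fix => (z : G)) (congrArg (fun z : Q => (z : Fix)) hk)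
      simpa using this⟩
    have hf : Function.Injective f := fun a b hab => by
      have := congrArg (fun z : (P ⊓ Fix : Subgroup G) => (z : G)) hab
      exact Subtype.ext (Subtype.ext (by simpa [f] using this))
    exact hQcard.trans (Nat.card_le_card_of_injective f hf)
  -- (2) `#(M/(1+φ)M) ≥ 4`
  have h2 : 4 ≤ Nat.card (Additive P ⧸ (⊤ : Submodule ℤ (Additive P)).map (1 + φ)) := by
    let NP : Additive P →ₗ[ℤ] Additive H := (MonoidHom.toAdditive (N.comp P.subtype)).toIntLinearMap
    have hNP_apply : ∀ x : Additive P, NP x = Additive.ofMul (N ((Additive.toMul x : P) : G)) := fun _ => rfl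
    have hle : (⊤ : Submodule ℤ (Additive P)).map (1 + φ) ≤ LinearMap.ker NP := by
      rintro _ ⟨x, -, rfl⟩
      rw [LinearMap.mem_ker, LinearMap.add_apply, Module.End.one_apply, hNP_apply]
      have hx : ((Additive.toMul (x + φ x) : P) : G) = ((Additive.toMul x : P) : G) * α ((Additive.toMul x : P) : G) := by
        rw [toMul_add, Subgroup.coe_mul, hφ_apply, toMul_ofMul, hαP_apply]
      rw [hx, hker _ (Additive.toMul x).2, ofMul_one]
    obtain ⟨Q⟩ : Nonempty (Sylow 2 H) := inferInstance
    have hQcard : 4 ∣ Nat.card Q := by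
      rw [Q.card_eq_multiplicity]
      have hne : Nat.card H ≠ 0 := Nat.card_pos.ne'
      have h22 : 2 ≤ (Nat.card H).factorization 2 :=
        (Nat.Prime.pow_dvd_iff_le_factorization Nat.prime_two hne).mp (by norm_num; exact h4)
      exact (pow_dvd_pow 2 h22).trans (by norm_num)
    have h4Q : 4 ≤ Nat.card Q := Nat.le_of_dvd Nat.card_pos hQcard
    have hrange : Nat.card Q ≤ Nat.card (LinearMap.range NP) := by
      let f : Q → LinearMap.range NP := fun q =>
        ⟨Additive.ofMul ((q : Q) : H), by
          obtain ⟨k, hk⟩ := Q.isPGroup' q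
          have hk' : ((q : Q) : H) ^ 2 ^ k = 1 := by
            have := congrArg (fun z : Q => (z : H)) hk
            simpa using this
          obtain ⟨a, haP, ha⟩ := exists_primary_preimage_of_surjective' N hN hk'
          exact ⟨Additive.ofMul ⟨a, haP⟩, by rw [hNP_apply, toMul_ofMul, ha]⟩⟩
      have hf : Function.Injective f := fun a b hab => by
        have := congrArg (fun z : LinearMap.range NP => Additive.toMul (z : Additive H)) hab
        exact Subtype.ext (by simpa [f] using this)
      exact Nat.card_le_card_of_injective f hf
    haveI : Finite (Additive P ⧸ (⊤ : Submodule ℤ (Additive P)).map (1 + φ)) :=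
      Finite.of_surjective _ (Submodule.Quotient.mk_surjective _)
    have hq : Nat.card (Additive P ⧸ LinearMap.ker NP) ≤ Nat.card (Additive P ⧸ (⊤ : Submodule ℤ (Additive P)).map (1 + φ)) :=
      Nat.card_le_card_of_surjective (Submodule.mapQ _ (LinearMap.ker NP) LinearMap.id hle) (by
        rintro ⟨x⟩
        exact ⟨Submodule.Quotient.mk x, rfl⟩)
    rw [Nat.card_congr (LinearMap.quotKerEquivRange NP).toEquiv] at hq
    exact (h4Q.trans hrange).trans hq
  -- (3) the converse-quadrant lemma, then `{g : g² = 1} ≃ ker (2 • 1)`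
  have h3 := FukudaDepth.four_le_card_quotient_two_of_four_le hM φ h1 h2
  set π : Module.End ℤ (Additive P) := (2 : ℤ) • 1 with hπ
  have hπ_apply : ∀ x : Additive P, π x = (2 : ℤ) • x := fun _ => rfl
  have hkerπ : Nat.card (LinearMap.ker π) = Nat.card (Additive P ⧸ (⊤ : Submodule ℤ (Additive P)).map π) := by
    have h1' : Nat.card (LinearMap.ker π) * Nat.card (LinearMap.range π) = Nat.card (Additive P) := by
      rw [← Nat.card_congr (LinearMap.quotKerEquivRange π).toEquiv]
      exact (Submodule.card_eq_card_quotient_mul_card (LinearMap.ker π)).symm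
    have h2' : Nat.card (LinearMap.range π) * Nat.card (Additive P ⧸ LinearMap.range π) = Nat.card (Additive P) :=
      (Submodule.card_eq_card_quotient_mul_card (LinearMap.range π)).symm
    have hpos : 0 < Nat.card (LinearMap.range π) := Nat.card_pos
    rw [Submodule.map_top]
    apply Nat.eq_of_mul_eq_mul_left hpos
    rw [mul_comm, h1', ← h2']
  have hsq : ∀ {g : G}, g ^ 2 = 1 → g ∈ P := fun {g} hg => hPmem.mpr ⟨1, by rw [pow_one]; exact hg⟩
  have hiff2 : ∀ x : Additive P, x ∈ LinearMap.ker π ↔ ((Additive.toMul x : P) : G) ^ 2 = 1 := by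
    intro x
    rw [LinearMap.mem_ker, hπ_apply, show ((2 : ℤ) • x = 0 ↔ (2 : ℕ) • x = 0) from by rw [← natCast_zsmul]; rfl]
    constructor
    · intro h
      have h' : (Additive.toMul x : P) ^ 2 = 1 := by
        have := congrArg Additive.toMul h
        rwa [toMul_nsmul, toMul_zero] at this
      have := congrArg (fun z : P => (z : G)) h'
      simpa using this
    · intro h
      have h' : (Additive.toMul x : P) ^ 2 = 1 := Subtype.ext (by simpa using h)
      have := congrArg Additive.ofMul h'
      rwa [ofMul_pow, ofMul_toMul, ofMul_one] at this
  let e2 : {g : G // g ^ 2 = 1} ≃ LinearMap.ker π :=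
    { toFun := fun g => ⟨Additive.ofMul ⟨(g : G), hsq g.2⟩, (hiff2 _).mpr (by simpa using g.2)⟩
      invFun := fun x => ⟨((Additive.toMul (x : Additive P) : P) : G), (hiff2 x.1).mp x.2⟩
      left_inv := fun g => Subtype.ext rfl
      right_inv := fun x => by apply Subtype.ext; apply Additive.toMul.injective; exact Subtype.ext rfl }
  rw [Nat.card_congr e2, hkerπ]
  exact h3

end Group
end Literature.NumberTheory.IwasawaTheory

end
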